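import Summits.QuantumFields.GaugeBoot.DiagonalRPTorusHalfAction
import Summits.QuantumFields.GaugeBoot.DiagonalRPTorusTubeGeometry
import Summits.QuantumFields.GaugeBoot.DiagonalRPTorusLonelyLink
import HarnessLib

/-!
# Plaquette pair terms of the back expansion in general dimension (gauge-boot, L3 sequel, 3/7)

HONEST FRAMING (cell `pub-gaugeboot`, page 1 of every file): the venture produces certified bounds
on lattice expectations at stated coupling, gauge group, dimension and torus size; NOT a mass gap,
NOT a continuum limit, NOT a string tension; NOT Yang–Mills-summit-bearing (barriers
`FixedCouplingUltralocality`, `PerturbativeInvisibility`). This module is bookkeeping for a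
structural NEGATIVE result (`DiagonalRPTorusInnerHalfNegativeHighDim`); it discharges nothing by
itself.

## Content (torus `(ℤ/L)^d`, any `d`, `L ≥ 3`, compact metrisable `G`, continuous `ρ`)

The general-dimension, plaquette-observable version of `DiagonalRPTorusClusterTerms` /
`DiagonalRPTorusLonelyLink`: `gfac` (`g_q = e^{β Re tr ρ(U_q)} - 1`), the PAIR TERM
`pairT ρ β Q u v = ∫ Re tr ρ(U_u) Re tr ρ(U_v) ∏_{q ∈ Q} g_q ∏ dU`, the bounds `abs_gfac_le`,
`abs_gfac_sub_le`, **`abs_pairT_le`** (`|T_Q| ≤ N² (2βN)^{|Q|}`); **`trickForm_plaqDiff_eq_sum`**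
(the trick form of `A = Re tr ρ(U_p) - Re tr ρ(U_{p'})` is the sum over `Q ⊆ restPlaqs` of
`T_Q(θp,p) - T_Q(θp,p') - T_Q(θp',p) + T_Q(θp',p')`); the LONELY-LINK reduction
**`pairT_eq_mul_pairT_erase`** (`T_Q = κ T_{Q∖q}`) and the CENTRE-TWIST vanishing
**`pairT_eq_zero_of_uncovered_right/left`** (`ρ z₀ = ω • 1`, `ω ≠ 1`: a link of an observable
covered by no plaquette of `Q` kills the term, via `∫ Re tr ρ(s w) ds = 0`).

Elementary strong-coupling bookkeeping (cf. M. Creutz, *Quarks, gluons and lattices* (1983) §10);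
no definition of record, no named fact.
-/

open MeasureTheory Complex Finset Function
open scoped ComplexOrder

namespace Summit.QuantumFields.GaugeBoot

open Literature.MathematicalPhysics.QuantumFieldTheory
open Literature.MathematicalPhysics.QuantumFieldTheory.PlaquetteLowerBound (reTr)

noncomputable section

namespace DiagRPTube

/-! ## Plaquette factors and pair terms -/

section Pair

variable {d L : ℕ} [NeZero L] {N : ℕ} {G : Type*} [Group G] [TopologicalSpace G]
  [IsTopologicalGroup G] [CompactSpace G] [MeasurableSpace G] [BorelSpace G]
  [SecondCountableTopology G] (ρ : G →* Matrix (Fin N) (Fin N) ℂ) (β : ℝ)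

/-- The plaquette factor `g_q(U) = e^{β Re tr ρ(U_q)} - 1` (general dimension). -/
def gfac (q : Plaquette d L) (U : GaugeConfig d L G) : ℝ :=
  Real.exp (β * WilsonRP.plaqRe ρ U q) - 1

/-- The PAIR TERM `T_Q(u,v) = ∫ Re tr ρ(U_u) Re tr ρ(U_v) ∏_{q ∈ Q} g_q ∏ dU` of two plaquettes. -/
def pairT (Q : Finset (Plaquette d L)) (u v : Plaquette d L) : ℝ :=
  ∫ U, WilsonRP.plaqRe ρ U u * WilsonRP.plaqRe ρ U v * ∏ q ∈ Q, gfac ρ β q U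
    ∂Measure.pi fun _ : Edge d L => haarProbability G

omit [NeZero L] [MeasurableSpace G] [BorelSpace G] [SecondCountableTopology G] in
/-- `|g_q| ≤ 2βN` for `0 ≤ β`, `βN ≤ 1`. -/
theorem abs_gfac_le (hρ : Continuous ρ) (hβ : 0 ≤ β) (hβN : β * N ≤ 1) (q : Plaquette d L)
    (U : GaugeConfig d L G) : |gfac ρ β q U| ≤ 2 * β * N := by
  have hx : |β * WilsonRP.plaqRe ρ U q| ≤ β * N := by
    rw [abs_mul, abs_of_nonneg hβ]
    exact mul_le_mul_of_nonneg_left (WilsonRP.abs_plaqRe_le ρ hρ U q) hβ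
  unfold gfac
  calc |Real.exp (β * WilsonRP.plaqRe ρ U q) - 1| ≤ 2 * |β * WilsonRP.plaqRe ρ U q| :=
        Real.abs_exp_sub_one_le (hx.trans hβN)
    _ ≤ 2 * (β * N) := by linarith
    _ = 2 * β * N := by ring

omit [NeZero L] [MeasurableSpace G] [BorelSpace G] [SecondCountableTopology G] in
/-- `|g_q - β Re tr ρ(U_q)| ≤ (βN)²` for `0 ≤ β`, `βN ≤ 1`. -/
theorem abs_gfac_sub_le (hρ : Continuous ρ) (hβ : 0 ≤ β) (hβN : β * N ≤ 1) (q : Plaquette d L)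
    (U : GaugeConfig d L G) : |gfac ρ β q U - β * WilsonRP.plaqRe ρ U q| ≤ (β * N) ^ 2 := by
  have hx : |β * WilsonRP.plaqRe ρ U q| ≤ β * N := by
    rw [abs_mul, abs_of_nonneg hβ]
    exact mul_le_mul_of_nonneg_left (WilsonRP.abs_plaqRe_le ρ hρ U q) hβ
  unfold gfac
  calc |Real.exp (β * WilsonRP.plaqRe ρ U q) - 1 - β * WilsonRP.plaqRe ρ U q|
      ≤ (β * WilsonRP.plaqRe ρ U q) ^ 2 := Real.abs_exp_sub_one_sub_id_le (hx.trans hβN)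
    _ ≤ (β * N) ^ 2 := by
        rw [← sq_abs]
        exact pow_le_pow_left₀ (abs_nonneg _) hx 2

omit [NeZero L] [MeasurableSpace G] [BorelSpace G] [SecondCountableTopology G] [CompactSpace G]
  [IsTopologicalGroup G] in
/-- The plaquette factor is continuous. -/
theorem continuous_gfac [ContinuousMul G] [ContinuousInv G] (hρ : Continuous ρ)
    (q : Plaquette d L) : Continuous (gfac ρ β q : GaugeConfig d L G → ℝ) := by
  unfold gfac
  exact (Real.continuous_exp.comp (continuous_const.mul (continuous_plaqRe ρ hρ q))).sub
    continuous_const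

omit [NeZero L] [MeasurableSpace G] [BorelSpace G] [SecondCountableTopology G] [CompactSpace G]
  [IsTopologicalGroup G] in
/-- The pair integrand is continuous. -/
theorem continuous_pairIntegrand [ContinuousMul G] [ContinuousInv G] (hρ : Continuous ρ)
    (Q : Finset (Plaquette d L)) (u v : Plaquette d L) : Continuous fun U : GaugeConfig d L G =>
      WilsonRP.plaqRe ρ U u * WilsonRP.plaqRe ρ U v * ∏ q ∈ Q, gfac ρ β q U :=
  ((continuous_plaqRe ρ hρ u).mul (continuous_plaqRe ρ hρ v)).mul
    (continuous_finsetProd _ fun q _ => continuous_gfac ρ β hρ q)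

/-- A continuous function on the compact configuration space is product-Haar integrable. -/
theorem integrable_of_continuous {E : Type*} [NormedAddCommGroup E] {F : GaugeConfig d L G → E}
    (hF : Continuous F) : Integrable F (Measure.pi fun _ : Edge d L => haarProbability G) := by
  obtain ⟨C, hC⟩ := isCompact_univ.exists_bound_of_continuousOn hF.continuousOn
  exact Integrable.of_bound hF.aestronglyMeasurable C (ae_of_all _ fun U => hC U (Set.mem_univ _))

omit [SecondCountableTopology G] in
/-- **Crude bound**: `|T_Q(u,v)| ≤ N² (2βN)^{|Q|}` for `0 ≤ β`, `βN ≤ 1`. -/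
theorem abs_pairT_le (hρ : Continuous ρ) (hβ : 0 ≤ β) (hβN : β * N ≤ 1)
    (Q : Finset (Plaquette d L)) (u v : Plaquette d L) :
    |pairT ρ β Q u v| ≤ N ^ 2 * (2 * β * N) ^ Q.card := by
  unfold pairT
  have hbd : ∀ U : GaugeConfig d L G, ‖WilsonRP.plaqRe ρ U u * WilsonRP.plaqRe ρ U v *
      ∏ q ∈ Q, gfac ρ β q U‖ ≤ N ^ 2 * (2 * β * N) ^ Q.card := fun U => by
    rw [Real.norm_eq_abs, abs_mul, abs_mul, abs_prod]
    have hP := WilsonRP.abs_plaqRe_le ρ hρ U u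
    have hQ := WilsonRP.abs_plaqRe_le ρ hρ U v
    have hprod : ∏ q ∈ Q, |gfac ρ β q U| ≤ (2 * β * N) ^ Q.card := by
      rw [← prod_const]
      exact prod_le_prod (fun q _ => abs_nonneg _) fun q _ => abs_gfac_le ρ β hρ hβ hβN q U
    calc |WilsonRP.plaqRe ρ U u| * |WilsonRP.plaqRe ρ U v| * ∏ q ∈ Q, |gfac ρ β q U|
        ≤ N * N * (2 * β * N) ^ Q.card :=
          mul_le_mul (mul_le_mul hP hQ (abs_nonneg _) (Nat.cast_nonneg _)) hprod
            (prod_nonneg fun q _ => abs_nonneg _) (by positivity)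
      _ = N ^ 2 * (2 * β * N) ^ Q.card := by ring
  have h := norm_integral_le_of_norm_le_const
    (μ := Measure.pi fun _ : Edge d L => haarProbability G) (ae_of_all _ hbd)
  rwa [probReal_univ, mul_one, Real.norm_eq_abs] at h

omit [SecondCountableTopology G] in
/-- `T_Q(u,v) = T_Q(v,u)`. -/
theorem pairT_comm (Q : Finset (Plaquette d L)) (u v : Plaquette d L) :
    pairT ρ β Q u v = pairT ρ β Q v u := by
  unfold pairT
  exact integral_congr_ae (ae_of_all _ fun U => by ring)

/-- **The trick form of a plaquette difference is a finite sum of pair terms**: for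
`A = Re tr ρ(U_p) - Re tr ρ(U_{p'})`,
`trickForm = Σ_{Q ⊆ rest} (T_Q(θp,p) - T_Q(θp,p') - T_Q(θp',p) + T_Q(θp',p'))`. -/
theorem trickForm_plaqDiff_eq_sum (hρ : Continuous ρ) (i j : Fin d) (h : ℕ) (p p' : Plaquette d L) :
    trickForm ρ i j h β (fun U => WilsonRP.plaqRe ρ U p - WilsonRP.plaqRe ρ U p') =
      ∑ Q ∈ (restPlaqs (L := L) i j h).powerset,
        (pairT ρ β Q (plaqSwap i j p) p - pairT ρ β Q (plaqSwap i j p) p' -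
          pairT ρ β Q (plaqSwap i j p') p + pairT ρ β Q (plaqSwap i j p') p') := by
  set R := restPlaqs (L := L) i j h with hR
  set π : Measure (GaugeConfig d L G) := Measure.pi fun _ : Edge d L => haarProbability G with hπ
  have hexp : ∀ U : GaugeConfig d L G, restWeight ρ i j h β U = ∑ Q ∈ R.powerset, ∏ q ∈ Q, gfac ρ β q U := by
    intro U
    unfold restWeight
    have h1 : (fun q => Real.exp (β * WilsonRP.plaqRe ρ U q)) = fun q => gfac ρ β q U + 1 := by
      funext q; unfold gfac; ring
    rw [h1, prod_add]
    simp [hR]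
  have hI : ∀ (Q : Finset (Plaquette d L)) (a b : Plaquette d L), Integrable
      (fun U : GaugeConfig d L G => WilsonRP.plaqRe ρ U a * WilsonRP.plaqRe ρ U b *
        ∏ q ∈ Q, gfac ρ β q U) π :=
    fun Q a b => integrable_of_continuous (continuous_pairIntegrand ρ β hρ Q a b)
  have hterm : ∀ Q : Finset (Plaquette d L),
      ∫ U, (WilsonRP.plaqRe ρ U (plaqSwap i j p) - WilsonRP.plaqRe ρ U (plaqSwap i j p')) *
          (WilsonRP.plaqRe ρ U p - WilsonRP.plaqRe ρ U p') * ∏ q ∈ Q, gfac ρ β q U ∂π =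
      pairT ρ β Q (plaqSwap i j p) p - pairT ρ β Q (plaqSwap i j p) p' -
          pairT ρ β Q (plaqSwap i j p') p + pairT ρ β Q (plaqSwap i j p') p' := by
    intro Q
    have hXX := hI Q (plaqSwap i j p) p
    have hXY := hI Q (plaqSwap i j p) p'
    have hYX := hI Q (plaqSwap i j p') p
    have hYY := hI Q (plaqSwap i j p') p'
    have h12 : Integrable (fun U : GaugeConfig d L G =>
        WilsonRP.plaqRe ρ U (plaqSwap i j p) * WilsonRP.plaqRe ρ U p * ∏ q ∈ Q, gfac ρ β q U -
          WilsonRP.plaqRe ρ U (plaqSwap i j p) * WilsonRP.plaqRe ρ U p' * ∏ q ∈ Q, gfac ρ β q U) π :=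
      hXX.sub hXY
    have h123 : Integrable (fun U : GaugeConfig d L G =>
        WilsonRP.plaqRe ρ U (plaqSwap i j p) * WilsonRP.plaqRe ρ U p * ∏ q ∈ Q, gfac ρ β q U -
          WilsonRP.plaqRe ρ U (plaqSwap i j p) * WilsonRP.plaqRe ρ U p' * ∏ q ∈ Q, gfac ρ β q U -
          WilsonRP.plaqRe ρ U (plaqSwap i j p') * WilsonRP.plaqRe ρ U p * ∏ q ∈ Q, gfac ρ β q U) π :=
      h12.sub hYX
    unfold pairT
    rw [← hπ, ← integral_sub hXX hXY, ← integral_sub h12 hYX, ← integral_add h123 hYY]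
    exact integral_congr_ae (ae_of_all _ fun U => by ring)
  have hIt : ∀ Q : Finset (Plaquette d L), Integrable
      (fun U : GaugeConfig d L G => (WilsonRP.plaqRe ρ U (plaqSwap i j p) -
          WilsonRP.plaqRe ρ U (plaqSwap i j p')) *
        (WilsonRP.plaqRe ρ U p - WilsonRP.plaqRe ρ U p') * ∏ q ∈ Q, gfac ρ β q U) π := fun Q =>
    integrable_of_continuous ((((continuous_plaqRe ρ hρ _).sub (continuous_plaqRe ρ hρ _)).mul
      ((continuous_plaqRe ρ hρ _).sub (continuous_plaqRe ρ hρ _))).mul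
      (continuous_finsetProd _ fun q _ => continuous_gfac ρ β hρ q))
  unfold trickForm
  simp_rw [plaqRe_configDiagSwap ρ hρ, hexp, mul_sum]
  rw [← hπ, integral_finsetSum _ fun Q _ => hIt Q]
  exact sum_congr rfl fun Q _ => hterm Q

end Pair

/-! ## Links of a plaquette; one-link updates -/

section Links

variable {d L : ℕ} {G : Type*} [Group G]

/-- **Updating one link of a plaquette**: for a link `ℓ` of `q`, uniformly in the configuration
`U`, either `U[ℓ ↦ s]_q = x s y` for all `s` or `U[ℓ ↦ s]_q = x s⁻¹ y` for all `s` (`x, y`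
depending on `U` only). -/
theorem plaquetteHolonomy_update_cases (hL : 3 ≤ L) (q : Plaquette d L) {ℓ : Edge d L}
    (hℓ : HasLink q ℓ) :
    (∀ U : GaugeConfig d L G, ∃ x y : G, ∀ s : G,
        plaquetteHolonomy (update U ℓ s) q.1 q.2.1.1 q.2.1.2 = x * s * y) ∨
      (∀ U : GaugeConfig d L G, ∃ x y : G, ∀ s : G,
        plaquetteHolonomy (update U ℓ s) q.1 q.2.1.1 q.2.1.2 = x * s⁻¹ * y) := by
  have hinj := link_injective hL q
  have hne : ∀ a b : Fin 4, a ≠ b → link q a ≠ link q b := fun a b h h' => h (hinj h')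
  obtain ⟨a, rfl⟩ := hℓ
  unfold plaquetteHolonomy
  rw [show (q.1, q.2.1.1) = link q 0 from rfl, show (q.1.shift q.2.1.1, q.2.1.2) = link q 1 from rfl,
    show (q.1.shift q.2.1.2, q.2.1.1) = link q 2 from rfl, show (q.1, q.2.1.2) = link q 3 from rfl]
  have h4 : a = 0 ∨ a = 1 ∨ a = 2 ∨ a = 3 := by fin_cases a <;> simp
  rcases h4 with rfl | rfl | rfl | rfl
  · refine Or.inl fun U => ⟨1, U (link q 1) * (U (link q 2))⁻¹ * (U (link q 3))⁻¹, fun s => ?_⟩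
    rw [update_self, update_of_ne (hne 1 0 (by decide)), update_of_ne (hne 2 0 (by decide)),
      update_of_ne (hne 3 0 (by decide))]
    group
  · refine Or.inl fun U => ⟨U (link q 0), (U (link q 2))⁻¹ * (U (link q 3))⁻¹, fun s => ?_⟩
    rw [update_self, update_of_ne (hne 0 1 (by decide)), update_of_ne (hne 2 1 (by decide)),
      update_of_ne (hne 3 1 (by decide))]
    group
  · refine Or.inr fun U => ⟨U (link q 0) * U (link q 1), (U (link q 3))⁻¹, fun s => ?_⟩
    rw [update_self, update_of_ne (hne 0 2 (by decide)), update_of_ne (hne 1 2 (by decide)),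
      update_of_ne (hne 3 2 (by decide))]
  · refine Or.inr fun U => ⟨U (link q 0) * U (link q 1) * (U (link q 2))⁻¹, 1, fun s => ?_⟩
    rw [update_self, update_of_ne (hne 0 3 (by decide)), update_of_ne (hne 1 3 (by decide)),
      update_of_ne (hne 2 3 (by decide)), mul_one]

/-- A product of plaquette factors over plaquettes not containing `ℓ` does not read `ℓ`. -/
theorem prod_update_of_not_hasLink {N : ℕ} (ρ : G →* Matrix (Fin N) (Fin N) ℂ) (β : ℝ)
    {Q : Finset (Plaquette d L)} {ℓ : Edge d L} (hQ : ∀ q ∈ Q, ¬ HasLink q ℓ)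
    (U : GaugeConfig d L G) (s : G) :
    ∏ q ∈ Q, gfac ρ β q (update U ℓ s) = ∏ q ∈ Q, gfac ρ β q U :=
  prod_congr rfl fun q hq => by unfold gfac; rw [plaqRe_update_of_not_hasLink ρ q (hQ q hq)]

end Links

/-! ## One-link averages: the constant and the centre-twist vanishing -/

section Average

variable {d L : ℕ} {N : ℕ} {G : Type*} [Group G] [TopologicalSpace G]
  [IsTopologicalGroup G] [CompactSpace G] [MeasurableSpace G] [BorelSpace G]
  (ρ : G →* Matrix (Fin N) (Fin N) ℂ) (β : ℝ)

/-- **The one-link average of a plaquette factor is a constant**: for a link `ℓ` of `q` there is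
`κ ∈ ℝ` with `∫ g_q(U[ℓ ↦ s]) ds = κ` for EVERY configuration `U`. -/
theorem exists_integral_gfac_update_eq (hL : 3 ≤ L) (q : Plaquette d L) {ℓ : Edge d L}
    (hℓ : HasLink q ℓ) :
    ∃ κ : ℝ, ∀ U : GaugeConfig d L G, ∫ s, gfac ρ β q (update U ℓ s) ∂haarProbability G = κ := by
  have hg : ∀ V : GaugeConfig d L G, gfac ρ β q V =
      (fun r : ℝ => Real.exp (β * r) - 1) (reTr ρ (plaquetteHolonomy V q.1 q.2.1.1 q.2.1.2)) :=
    fun V => rfl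
  rcases plaquetteHolonomy_update_cases (G := G) hL q hℓ with h | h
  · refine ⟨∫ s, (Real.exp (β * reTr ρ s) - 1) ∂haarProbability G, fun U => ?_⟩
    obtain ⟨x, y, hxy⟩ := h U
    simp_rw [hg, hxy]
    exact DiagRPSUN.integral_comp_reTr_mul_mul ρ (fun r => Real.exp (β * r) - 1) x y
  · refine ⟨∫ s, (Real.exp (β * reTr ρ s⁻¹) - 1) ∂haarProbability G, fun U => ?_⟩
    obtain ⟨x, y, hxy⟩ := h U
    simp_rw [hg, hxy]
    exact DiagRPSUN.integral_comp_reTr_mul_inv_mul ρ (fun r => Real.exp (β * r) - 1) x y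

/-- **Centre twist**: if `ρ z₀ = ω • 1` with `ω ≠ 1`, then `∫ Re tr ρ(s w) ds = 0` for every `w`
(left invariance of Haar measure under `z₀`). -/
theorem integral_reTr_mul_eq_zero (hρ : Continuous ρ) {z₀ : G} {ω : ℂ}
    (hz₀ : ρ z₀ = ω • (1 : Matrix (Fin N) (Fin N) ℂ)) (hω : ω ≠ 1) (w : G) :
    ∫ s, reTr ρ (s * w) ∂haarProbability G = 0 := by
  have hfc : Continuous fun s : G => (ρ (s * w)).trace := hρ.matrix_trace.comp (continuous_mul_const w)
  have hfi : Integrable (fun s : G => (ρ (s * w)).trace) (haarProbability G) :=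
    hfc.integrable_of_hasCompactSupport (HasCompactSupport.of_compactSpace _)
  have htwist : ∀ s, (ρ (z₀ * s * w)).trace = ω * (ρ (s * w)).trace := fun s => by
    rw [mul_assoc, map_mul, hz₀, Matrix.smul_mul, Matrix.one_mul, Matrix.trace_smul, smul_eq_mul]
  have hinv : ∫ s, (ρ (z₀ * s * w)).trace ∂haarProbability G = ∫ s, (ρ (s * w)).trace ∂haarProbability G :=
    integral_mul_left_eq_self (μ := haarProbability G) (fun s => (ρ (s * w)).trace) z₀
  simp_rw [htwist, integral_const_mul] at hinv
  have hzero : ∫ s, (ρ (s * w)).trace ∂haarProbability G = 0 := by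
    have : (ω - 1) * ∫ s, (ρ (s * w)).trace ∂haarProbability G = 0 := by
      rw [sub_mul, one_mul, hinv, sub_self]
    rcases mul_eq_zero.1 this with h | h
    · exact absurd (sub_eq_zero.1 h) hω
    · exact h
  have hre := integral_re hfi
  simp only [RCLike.re_to_complex, hzero, Complex.zero_re] at hre
  unfold reTr
  exact hre

/-- `∫ Re tr ρ(x s y) ds = 0` under the centre twist. -/
theorem integral_reTr_mul_mul_eq_zero (hρ : Continuous ρ) {z₀ : G} {ω : ℂ}
    (hz₀ : ρ z₀ = ω • (1 : Matrix (Fin N) (Fin N) ℂ)) (hω : ω ≠ 1) (x y : G) :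
    ∫ s, reTr ρ (x * s * y) ∂haarProbability G = 0 := by
  have h1 : ∀ s : G, reTr ρ (x * s * y) = reTr ρ (s * (y * x)) := fun s => by
    rw [mul_assoc, DiagRPSUN.reTr_mul_comm ρ x (s * y), mul_assoc]
  simp_rw [h1]
  exact integral_reTr_mul_eq_zero ρ hρ hz₀ hω (y * x)

/-- `∫ Re tr ρ(x s⁻¹ y) ds = 0` under the centre twist (`Re tr ρ(g⁻¹) = Re tr ρ(g)`). -/
theorem integral_reTr_mul_inv_mul_eq_zero (hρ : Continuous ρ) {z₀ : G} {ω : ℂ}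
    (hz₀ : ρ z₀ = ω • (1 : Matrix (Fin N) (Fin N) ℂ)) (hω : ω ≠ 1) (x y : G) :
    ∫ s, reTr ρ (x * s⁻¹ * y) ∂haarProbability G = 0 := by
  have h1 : ∀ s : G, reTr ρ (x * s⁻¹ * y) = reTr ρ (s * (y * x)⁻¹) := fun s => by
    have : x * s⁻¹ * y = (y⁻¹ * (s * x⁻¹))⁻¹ := by group
    rw [this, show reTr ρ (y⁻¹ * (s * x⁻¹))⁻¹ = reTr ρ (y⁻¹ * (s * x⁻¹)) from
      Literature.RepresentationTheory.CompactGroups.CompactGroup.re_trace_map_inv ρ hρ _,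
      DiagRPSUN.reTr_mul_comm, mul_assoc, mul_inv_rev]
  simp_rw [h1]
  exact integral_reTr_mul_eq_zero ρ hρ hz₀ hω _

end Average

/-! ## The lonely-link reduction and the vanishing of uncovered terms -/

section Lonely

variable {d L : ℕ} [NeZero L] {N : ℕ} {G : Type*} [Group G] [TopologicalSpace G]
  [IsTopologicalGroup G] [CompactSpace G] [MeasurableSpace G] [BorelSpace G]
  [SecondCountableTopology G] (ρ : G →* Matrix (Fin N) (Fin N) ℂ) (β : ℝ)

/-- **The lonely-link reduction.** Let `q ∈ Q` have a link `ℓ` lying in no other plaquette of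
`Q` and in neither observable plaquette `u, v`. Then `T_Q(u,v) = κ T_{Q∖{q}}(u,v)` for a real
constant `κ`. -/
theorem pairT_eq_mul_pairT_erase (hρ : Continuous ρ) (hL : 3 ≤ L) {Q : Finset (Plaquette d L)}
    {q : Plaquette d L} (hq : q ∈ Q) {ℓ : Edge d L} (hℓ : HasLink q ℓ)
    (hlone : ∀ q' ∈ Q, q' ≠ q → ¬ HasLink q' ℓ) {u v : Plaquette d L} (hu : ¬ HasLink u ℓ)
    (hv : ¬ HasLink v ℓ) :
    ∃ κ : ℝ, pairT ρ β Q u v = κ * pairT ρ β (Q.erase q) u v := by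
  obtain ⟨κ, hκ⟩ := exists_integral_gfac_update_eq ρ β (G := G) hL q hℓ
  refine ⟨κ, ?_⟩
  unfold pairT
  rw [← integral_const_mul]
  refine DiagRPSUN.integral_pi_update_of_forall (haarProbability G) ℓ
    (integrable_of_continuous (continuous_pairIntegrand ρ β hρ Q u v)) fun U => ?_
  have hsplit : ∀ V : GaugeConfig d L G, ∏ q' ∈ Q, gfac ρ β q' V =
      gfac ρ β q V * ∏ q' ∈ Q.erase q, gfac ρ β q' V := fun V => (mul_prod_erase Q _ hq).symm
  have hrest : ∀ s : G, ∏ q' ∈ Q.erase q, gfac ρ β q' (update U ℓ s) =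
      ∏ q' ∈ Q.erase q, gfac ρ β q' U := fun s =>
    prod_update_of_not_hasLink ρ β (fun q' hq' => hlone q' (mem_of_mem_erase hq')
      (ne_of_mem_erase hq')) U s
  have hF : ∀ s : G, WilsonRP.plaqRe ρ (update U ℓ s) u * WilsonRP.plaqRe ρ (update U ℓ s) v *
      ∏ q' ∈ Q, gfac ρ β q' (update U ℓ s) =
      (WilsonRP.plaqRe ρ U u * WilsonRP.plaqRe ρ U v * ∏ q' ∈ Q.erase q, gfac ρ β q' U) *
        gfac ρ β q (update U ℓ s) := fun s => by
    rw [plaqRe_update_of_not_hasLink ρ u hu, plaqRe_update_of_not_hasLink ρ v hv, hsplit, hrest]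
    ring
  simp_rw [hF]
  rw [integral_const_mul, hκ U]
  ring

/-- **An uncovered link of the right observable kills the term** (centre twist): if a link `ℓ` of
`v` lies in no plaquette of `Q` and not in `u`, then `T_Q(u,v) = 0`. -/
theorem pairT_eq_zero_of_uncovered_right (hρ : Continuous ρ) (hL : 3 ≤ L) {z₀ : G} {ω : ℂ}
    (hz₀ : ρ z₀ = ω • (1 : Matrix (Fin N) (Fin N) ℂ)) (hω : ω ≠ 1) {Q : Finset (Plaquette d L)}
    {u v : Plaquette d L} {ℓ : Edge d L} (hv : HasLink v ℓ) (hu : ¬ HasLink u ℓ)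
    (hQ : ∀ q ∈ Q, ¬ HasLink q ℓ) : pairT ρ β Q u v = 0 := by
  unfold pairT
  rw [← integral_zero (α := GaugeConfig d L G)]
  refine DiagRPSUN.integral_pi_update_of_forall (haarProbability G) ℓ
    (integrable_of_continuous (continuous_pairIntegrand ρ β hρ Q u v)) fun U => ?_
  have hF : ∀ s : G, WilsonRP.plaqRe ρ (update U ℓ s) u * WilsonRP.plaqRe ρ (update U ℓ s) v *
      ∏ q ∈ Q, gfac ρ β q (update U ℓ s) =
      (WilsonRP.plaqRe ρ U u * ∏ q ∈ Q, gfac ρ β q U) * WilsonRP.plaqRe ρ (update U ℓ s) v :=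
    fun s => by rw [plaqRe_update_of_not_hasLink ρ u hu, prod_update_of_not_hasLink ρ β hQ]; ring
  simp_rw [hF]
  rw [integral_const_mul]
  have hzero : ∫ s, WilsonRP.plaqRe ρ (update U ℓ s) v ∂haarProbability G = 0 := by
    unfold WilsonRP.plaqRe
    rcases plaquetteHolonomy_update_cases (G := G) hL v hv with h | h
    · obtain ⟨x, y, hxy⟩ := h U
      simp_rw [hxy]
      exact integral_reTr_mul_mul_eq_zero ρ hρ hz₀ hω x y
    · obtain ⟨x, y, hxy⟩ := h U
      simp_rw [hxy]
      exact integral_reTr_mul_inv_mul_eq_zero ρ hρ hz₀ hω x y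
  rw [hzero, mul_zero]

/-- **An uncovered link of the left observable kills the term.** -/
theorem pairT_eq_zero_of_uncovered_left (hρ : Continuous ρ) (hL : 3 ≤ L) {z₀ : G} {ω : ℂ}
    (hz₀ : ρ z₀ = ω • (1 : Matrix (Fin N) (Fin N) ℂ)) (hω : ω ≠ 1) {Q : Finset (Plaquette d L)}
    {u v : Plaquette d L} {ℓ : Edge d L} (hu : HasLink u ℓ) (hv : ¬ HasLink v ℓ)
    (hQ : ∀ q ∈ Q, ¬ HasLink q ℓ) : pairT ρ β Q u v = 0 := by
  rw [pairT_comm, pairT_eq_zero_of_uncovered_right ρ β hρ hL hz₀ hω hu hv hQ]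

end Lonely

end DiagRPTube

end

end Summit.QuantumFields.GaugeBoot
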